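import Mathlib
import Literature.Analysis.FluidPDE.VectorCalculus
import Summits.NavierStokesRegularity.NavierStokesRegularity.Theorems.FilamentSkeletonRssSkeletonEquilibriumLineBiotSavart

/-!
# The slip of the straight `C₄` configuration at finite `Γ`

Tools stub `stub_lineSlipModel` of line `Sketch` (crux `SkeletonEquilibrium`, thesis
`FilamentSkeletonRss`). For the four straight vortex lines `Ξ_k(σ) = √Γ P_k + σ e_k` — the `C₄`
orbit (rotation by `90°` about `e₃`) of `P₀ = (1, 0, −10)`, `e₀ = (0, 4/5, 3/5)` — with
circulations `16πΓ` (so `Γγ/4π = 4Γ`) and Leray–rotation drift `½y + (5/8) e₃ × y`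
(`α = −5/8`), the tangential component along line `0`, at the point `Ξ₀(τ) = √Γ P₀ + τ e₀`, of
(regularised Biot–Savart velocity of the four lines) + (drift) is exactly `√Γ · W_Γ(τ/√Γ)` with
`W_Γ(t) = t/2 − 5/2 + 2400/(272t² − 320t + 425 + 625/(2Γ)) + 2400/(144t² + 625 + 625/(4Γ))
  + 2400/(272t² + 320t + 425 + 625/(2Γ))`.

Proof: write `Γ = s²`, `τ = s t`, so `Ξ₀(τ) = s (P₀ + t e₀)`. Each line integral is evaluated in
closed form by the landed `stub_lineBiotSavart` (Lorentzian `2/(d² + 1)` times `e_k × (x − √Γ P_k)`);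
with `x − s P_k = s d_k`, `d_k = P₀ − P_k + t e₀`, the `k`-th tangential component is
`4s² · 2/(s² q_k + 1) · s m_k` where `q_k = ‖d_k‖² − ⟨d_k, e_k⟩²` and `m_k = ⟨e_k × d_k, e₀⟩` are
read off in coordinates (`m₀ = 0`: the self line does not slip; `m₁ = m₃ = 24/25`, `m₂ = 48/25`;
`q₁,₃ = (2/625)(272t² ∓ 320t + 425)`, `q₂ = (4/625)(144t² + 625)`), and the drift contributes
`s (t/2 − 5/2)`. The rest is `field_simp; ring`.
-/

noncomputable section

open MeasureTheory
open Literature.Analysis.FluidPDE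

namespace Summit.NavierStokesRegularity.NavierStokesRegularity.Theorems.SkeletonEquilibrium.Sketch
set_option linter.dupNamespace false

/-- Coordinates of the inner product on `ℝ³`. [folklore] -/
private theorem inner_three (a b : EuclideanSpace ℝ (Fin 3)) :
    inner ℝ a b = a 0 * b 0 + a 1 * b 1 + a 2 * b 2 := by
  simp [PiLp.inner_apply, Fin.sum_univ_three, mul_comm]

/-- `‖a‖² = Σ aᵢ²` on `ℝ³`. [folklore] -/
private theorem norm_sq_three (a : EuclideanSpace ℝ (Fin 3)) :
    ‖a‖ ^ 2 = a 0 ^ 2 + a 1 ^ 2 + a 2 ^ 2 := by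
  rw [EuclideanSpace.real_norm_sq_eq, Fin.sum_univ_three]

/-- Coordinates of the triple product `⟨a × b, c⟩` on `ℝ³`. [folklore] -/
private theorem inner_cross_three (a b c : EuclideanSpace ℝ (Fin 3)) :
    inner ℝ (cross a b) c = (a 1 * b 2 - a 2 * b 1) * c 0 + (a 2 * b 0 - a 0 * b 2) * c 1
      + (a 0 * b 1 - a 1 * b 0) * c 2 := by
  rw [inner_three]
  simp [cross, cross_apply]

/-- `⟨u × w, u⟩ = 0`. [folklore] -/
private theorem inner_cross_self_left (u w : EuclideanSpace ℝ (Fin 3)) :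
    inner ℝ (cross u w) u = 0 := by
  rw [inner_cross_three]; ring

/-- `v × (s • d) = s • (v × d)`. [folklore] -/
private theorem cross_smul_right (v d : EuclideanSpace ℝ (Fin 3)) (s : ℝ) :
    cross v (s • d) = s • cross v d := by
  rw [← crossCLM_apply, map_smul, crossCLM_apply]

/-- The scaling skeleton of one interaction term: with `x = s A + (s t) u` and `x − s B = s d`,
`d = A − B + t u`, the tangential component `⟨c • (2/(‖x − sB‖² − ⟨x − sB, v⟩² + 1)) • v × (x − sB), u⟩`
equals `c · 2/(s² q + 1) · s m` where `q = ‖d‖² − ⟨d, v⟩²`, `m = ⟨v × d, u⟩`. [folklore] -/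
private theorem inner_term_eq (A B u v : EuclideanSpace ℝ (Fin 3)) (s t c q m : ℝ)
    (hq : ‖A - B + t • u‖ ^ 2 - (inner ℝ (A - B + t • u) v) ^ 2 = q)
    (hm : inner ℝ (cross v (A - B + t • u)) u = m) :
    inner ℝ (c • ((2 / (‖(s • A + (s * t) • u) - s • B‖ ^ 2
      - (inner ℝ ((s • A + (s * t) • u) - s • B) v) ^ 2 + 1)) • cross v ((s • A + (s * t) • u) - s • B))) u
      = c * (2 / (s ^ 2 * q + 1)) * (s * m) := by
  have hd : (s • A + (s * t) • u) - s • B = s • (A - B + t • u) := by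
    rw [smul_add, smul_sub, smul_smul]; abel
  rw [hd, norm_smul, real_inner_smul_left, mul_pow, Real.norm_eq_abs, sq_abs, cross_smul_right,
    real_inner_smul_left, real_inner_smul_left, real_inner_smul_left, hm, ← hq]
  ring

/-- The four tangents `e_k` are unit vectors. [folklore] -/
private theorem norm_tangent (e : Fin 4 → EuclideanSpace ℝ (Fin 3))
    (he : e = ![!₂[(0 : ℝ), 4 / 5, 3 / 5], !₂[(-4 / 5 : ℝ), 0, 3 / 5], !₂[(0 : ℝ), -4 / 5, 3 / 5],
      !₂[(4 / 5 : ℝ), 0, 3 / 5]]) (k : Fin 4) : ‖e k‖ = 1 := by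
  rw [← pow_eq_one_iff_of_nonneg (norm_nonneg _) two_ne_zero, norm_sq_three]
  subst he
  fin_cases k <;> simp <;> norm_num

/-- Line `1` seen from line `0`: `q₁ = (2/625)(272t² − 320t + 425)`, `m₁ = 24/25`. [folklore] -/
private theorem data_one (P e : Fin 4 → EuclideanSpace ℝ (Fin 3))
    (hP : P = ![!₂[(1 : ℝ), 0, -10], !₂[(0 : ℝ), 1, -10], !₂[(-1 : ℝ), 0, -10], !₂[(0 : ℝ), -1, -10]])
    (he : e = ![!₂[(0 : ℝ), 4 / 5, 3 / 5], !₂[(-4 / 5 : ℝ), 0, 3 / 5], !₂[(0 : ℝ), -4 / 5, 3 / 5],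
      !₂[(4 / 5 : ℝ), 0, 3 / 5]]) (t : ℝ) :
    ‖P 0 - P 1 + t • e 0‖ ^ 2 - (inner ℝ (P 0 - P 1 + t • e 0) (e 1)) ^ 2
        = 2 / 625 * (272 * t ^ 2 - 320 * t + 425) ∧
      inner ℝ (cross (e 1) (P 0 - P 1 + t • e 0)) (e 0) = 24 / 25 := by
  subst hP he
  rw [norm_sq_three, inner_three, inner_cross_three]
  simp
  constructor <;> ring

/-- Line `2` seen from line `0`: `q₂ = (4/625)(144t² + 625)`, `m₂ = 48/25`. [folklore] -/
private theorem data_two (P e : Fin 4 → EuclideanSpace ℝ (Fin 3))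
    (hP : P = ![!₂[(1 : ℝ), 0, -10], !₂[(0 : ℝ), 1, -10], !₂[(-1 : ℝ), 0, -10], !₂[(0 : ℝ), -1, -10]])
    (he : e = ![!₂[(0 : ℝ), 4 / 5, 3 / 5], !₂[(-4 / 5 : ℝ), 0, 3 / 5], !₂[(0 : ℝ), -4 / 5, 3 / 5],
      !₂[(4 / 5 : ℝ), 0, 3 / 5]]) (t : ℝ) :
    ‖P 0 - P 2 + t • e 0‖ ^ 2 - (inner ℝ (P 0 - P 2 + t • e 0) (e 2)) ^ 2
        = 4 / 625 * (144 * t ^ 2 + 625) ∧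
      inner ℝ (cross (e 2) (P 0 - P 2 + t • e 0)) (e 0) = 48 / 25 := by
  subst hP he
  rw [norm_sq_three, inner_three, inner_cross_three]
  simp
  constructor <;> ring

/-- Line `3` seen from line `0`: `q₃ = (2/625)(272t² + 320t + 425)`, `m₃ = 24/25`. [folklore] -/
private theorem data_three (P e : Fin 4 → EuclideanSpace ℝ (Fin 3))
    (hP : P = ![!₂[(1 : ℝ), 0, -10], !₂[(0 : ℝ), 1, -10], !₂[(-1 : ℝ), 0, -10], !₂[(0 : ℝ), -1, -10]])
    (he : e = ![!₂[(0 : ℝ), 4 / 5, 3 / 5], !₂[(-4 / 5 : ℝ), 0, 3 / 5], !₂[(0 : ℝ), -4 / 5, 3 / 5],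
      !₂[(4 / 5 : ℝ), 0, 3 / 5]]) (t : ℝ) :
    ‖P 0 - P 3 + t • e 0‖ ^ 2 - (inner ℝ (P 0 - P 3 + t • e 0) (e 3)) ^ 2
        = 2 / 625 * (272 * t ^ 2 + 320 * t + 425) ∧
      inner ℝ (cross (e 3) (P 0 - P 3 + t • e 0)) (e 0) = 24 / 25 := by
  subst hP he
  rw [norm_sq_three, inner_three, inner_cross_three]
  simp
  constructor <;> ring

/-- The drift `½x + (5/8) e₃ × x` at `x = s(P₀ + t e₀)` slips by `s (t/2 − 5/2)` along `e₀`
(`⟨P₀, e₀⟩ = −6`, `⟨e₃ × P₀, e₀⟩ = 4/5`, `⟨e₃ × e₀, e₀⟩ = 0`). [folklore] -/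
private theorem drift_slip (P e : Fin 4 → EuclideanSpace ℝ (Fin 3))
    (hP : P = ![!₂[(1 : ℝ), 0, -10], !₂[(0 : ℝ), 1, -10], !₂[(-1 : ℝ), 0, -10], !₂[(0 : ℝ), -1, -10]])
    (he : e = ![!₂[(0 : ℝ), 4 / 5, 3 / 5], !₂[(-4 / 5 : ℝ), 0, 3 / 5], !₂[(0 : ℝ), -4 / 5, 3 / 5],
      !₂[(4 / 5 : ℝ), 0, 3 / 5]]) (s t : ℝ) :
    inner ℝ ((1 / 2 : ℝ) • (s • P 0 + (s * t) • e 0) - (-5 / 8 : ℝ) •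
      cross (EuclideanSpace.single (2 : Fin 3) (1 : ℝ)) (s • P 0 + (s * t) • e 0)) (e 0)
        = s * (t / 2 - 5 / 2) := by
  subst hP he
  rw [inner_sub_left, real_inner_smul_left, real_inner_smul_left, inner_three, inner_cross_three]
  simp
  ring

/-- **Tools stub T4** (`stub_lineSlipModel`): the slip of the STRAIGHT `C₄` configuration at finite
`Γ`. For the four lines `Ξ_k(σ) = √Γ P_k + σ e_k` (the `C₄` orbit of `P₀ = (1,0,−10)`,
`e₀ = (0,4/5,3/5)`), circulations `16πΓ`, `α = −5/8`, the tangential component along line `0` at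
`Ξ₀(τ)` of (regularised Biot–Savart velocity + Leray–rotation drift) is EXACTLY `√Γ · W_Γ(τ/√Γ)`,
`W_Γ(t) = t/2 − 5/2 + 2400/(272t² − 320t + 425 + 625/(2Γ)) + 2400/(144t² + 625 + 625/(4Γ))
+ 2400/(272t² + 320t + 425 + 625/(2Γ))` — the model `W` of `stub_innerCertificate` up to the
`O(1/Γ)` core terms (three applications of `stub_lineBiotSavart`; the self line contributes `0`).
[folklore] -/
theorem stub_lineSlipModel : ∀ (P e : Fin 4 → EuclideanSpace ℝ (Fin 3)), P = ![!₂[(1 : ℝ), 0, -10], !₂[(0 : ℝ), 1, -10], !₂[(-1 : ℝ), 0, -10], !₂[(0 : ℝ), -1, -10]] → e = ![!₂[(0 : ℝ), 4 / 5, 3 / 5], !₂[(-4 / 5 : ℝ), 0, 3 / 5], !₂[(0 : ℝ), -4 / 5, 3 / 5], !₂[(4 / 5 : ℝ), 0, 3 / 5]] → ∀ (Γ τ : ℝ), 0 < Γ → inner ℝ ((∑ k : Fin 4, (Γ * (16 * Real.pi) / (4 * Real.pi)) • ∫ σ : ℝ, ((‖(Real.sqrt Γ • P 0 + τ • e 0)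 - (Real.sqrt Γ • P k + σ • e k)‖ ^ 2 + 1) ^ (3 / 2 : ℝ))⁻¹ • Literature.Analysis.FluidPDE.cross (e k) ((Real.sqrt Γ • P 0 + τ • e 0) - (Real.sqrt Γ • P k + σ • e k))) + (1 / 2 : ℝ) • (Real.sqrt Γ • P 0 + τ • e 0) - (-5 / 8 : ℝ) • Literature.Analysis.FluidPDE.cross (EuclideanSpace.single (2 : Fin 3) (1 : ℝ)) (Real.sqrt Γ • P 0 + τ • e 0)) (e 0) = Real.sqrt Γ * ((τ / Real.sqrt Γ) / 2 - 5 / 2 + 2400 / (272 * (τ / Real.sqrt Γ) ^ 2 - 320 * (τ / Real.sqrt Γ) + 425 + 625 / (2 * Γ)) + 2400 / (144 * (τ / Real.sqrt Γ) ^ 2 + 625 + 625 / (4 * Γ)) + 2400 / (272 * (τ / Real.sqrt Γ) ^ 2 + 320 * (τ / Real.sqrt Γ) + 425 + 625 / (2 * Γ))) := by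
  intro P e hP he Γ τ hΓ
  have hn : ∀ k, ‖e k‖ = 1 := norm_tangent e he
  obtain ⟨s, hs, rfl⟩ : ∃ s : ℝ, 0 < s ∧ Γ = s ^ 2 :=
    ⟨Real.sqrt Γ, Real.sqrt_pos.2 hΓ, (Real.sq_sqrt hΓ.le).symm⟩
  rw [Real.sqrt_sq hs.le]
  obtain ⟨t, rfl⟩ : ∃ t : ℝ, τ = s * t := ⟨τ / s, by field_simp⟩
  have hts : s * t / s = t := by field_simp
  have hc : s ^ 2 * (16 * Real.pi) / (4 * Real.pi) = 4 * s ^ 2 := by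
    have hπ : Real.pi ≠ 0 := Real.pi_ne_zero
    field_simp
    ring
  simp only [hts, hc]
  have hI := fun k : Fin 4 =>
    (stub_lineBiotSavart (s • P k) (e k) (s • P 0 + (s * t) • e 0) (hn k)).2
  rw [add_sub_assoc, inner_add_left, sum_inner, drift_slip P e hP he s t]
  simp only [Fin.sum_univ_four]
  rw [hI 0, hI 1, hI 2, hI 3]
  obtain ⟨hq1, hm1⟩ := data_one P e hP he t
  obtain ⟨hq2, hm2⟩ := data_two P e hP he t
  obtain ⟨hq3, hm3⟩ := data_three P e hP he t
  rw [inner_term_eq (P 0) (P 0) (e 0) (e 0) s t _ _ 0 rfl (inner_cross_self_left _ _),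
    inner_term_eq (P 0) (P 1) (e 0) (e 1) s t _ _ _ hq1 hm1,
    inner_term_eq (P 0) (P 2) (e 0) (e 2) s t _ _ _ hq2 hm2,
    inner_term_eq (P 0) (P 3) (e 0) (e 3) s t _ _ _ hq3 hm3, mul_zero, mul_zero, zero_add]
  have hp1 : 0 < 272 * t ^ 2 - 320 * t + 425 := by nlinarith [sq_nonneg (272 * t - 160)]
  have hp3 : 0 < 272 * t ^ 2 + 320 * t + 425 := by nlinarith [sq_nonneg (272 * t + 160)]
  field_simp
  ring

end Summit.NavierStokesRegularity.NavierStokesRegularity.Theorems.SkeletonEquilibrium.Sketch
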